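import Mathlib
import Summits.NavierStokesRegularity.NavierStokesRegularity.Theorems.SubOnsagerCeilingSideBranchLiveBalance
import Summits.NavierStokesRegularity.NavierStokesRegularity.Theorems.SubOnsagerCeilingSideBranchChainDrive
import HarnessLib

/-!
# Route SubOnsagerCeiling — the ESCAPED-ENERGY functional of the side-branch table `α_SB`: monotonicity
# and the shell identities (helper file for item stmt-NavierStokesRegularity-25507 `OrthantTailCeiling`;
# `--supports`; def-free)

Sixth brick of the ENGINE for the Onsager-critical escape construction (`SideBranchCriticalEscapeEstimateAt`,
p823602; threshold step p824157).  With `B_k(u) = Σ_{j ≤ k} Σ_i ½X_{i,j}(u)²`, `E₀ = Σ_i ½X₀_i²` and the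
escaped energy past the chain mode `x_k`, `A_k(u) = E₀ − B_k(u) + ½s_k(u)²`, the Katz–Pavlović-type
induction over shells needs, besides the threshold step, only:

* `sideBranch_escaped_monotone` — `A_k` is non-decreasing on `[0,s]` along a regular solution that is
  non-negative on the shells `≥ 0` (`A_k' ≥ Λ_k x_k² x_{k+1} ≥ 0`, `sideBranch_liveBlock_deriv_ge`);
* `sideBranch_chain_sq_succ` — the DRIVER identity one shell up:
  `½x_{k+1}² = (A_k − A_{k+1}) − (½s_k² + ½z_{k+1}²) − ½X_{3,k+1}²` (the side unit `(s_k, z_{k+1})` and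
  the idle mode are what the SPLIT estimate must control);
* `sideBranch_chain_sq_zero` — on the datum shell: `½x_0² = E₀ − A_0 − ½z_0² − ½X_{3,0}²`.

HONEST FRAMING: elementary bookkeeping on a Tao-type MODEL lattice ODE (route SubOnsagerCeiling, rung
TL-M2Break); a brick toward a construction NOT carried out here; nothing bears on Navier–Stokes
regularity; no crux is settled here. [cite: Tao2016AveragedNS, §4 (4.2)–(4.3)]
-/

noncomputable section

-- the sub-problem namespace `NavierStokesRegularity.NavierStokesRegularity` is the tree's layout (D-0017)
set_option linter.dupNamespace false

namespace Summit.NavierStokesRegularity.NavierStokesRegularity.Theorems.SubOnsagerCeiling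

open Set
open Literature.Analysis.FluidPDE.TaoCascade

section Solution

variable {ε₀ ν s : ℝ} {X₀ : Fin 4 → ℝ} {X : Fin 4 → ℤ → ℝ → ℝ}

/-- **The escaped energy only grows.** Along a regular solution of the `ν`-viscous `α_SB` lattice on
`[0,s]` (`ν ≥ 0`, no shells below `0`) that is non-negative on the shells `≥ 0`,
`u ↦ E₀ − B_k(u) + ½s_k(u)²` is non-decreasing on `[0,s]`. [this file] -/
theorem sideBranch_escaped_monotone (hε : 0 < ε₀) (hν : 0 ≤ ν)
    (hlow : ∀ (i : Fin 4) (k : ℤ), k < 0 → ∀ t : ℝ, X i k t = 0)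
    (hder : ∀ (i : Fin 4) (k : ℤ), ∀ t ∈ Icc (0 : ℝ) s, HasDerivWithinAt (X i k)
      (quadTerm ε₀ sideBranchTable X i k t - ν * (1 + ε₀) ^ ((2 : ℝ) * k) * X i k t)
      (Icc (0 : ℝ) s) t)
    (hpos : ∀ t ∈ Icc (0 : ℝ) s, ∀ (i : Fin 4) (k : ℤ), 0 ≤ k → 0 ≤ X i k t)
    (k : ℕ) (E₀ : ℝ) {u₁ u₂ : ℝ} (hu₁ : 0 ≤ u₁) (hu : u₁ ≤ u₂) (hu₂ : u₂ ≤ s) :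
    E₀ - (∑ j ∈ Finset.range (k + 1), ∑ i : Fin 4, (1 / 2 : ℝ) * X i (j : ℤ) u₁ ^ 2) +
        (1 / 2 : ℝ) * X 1 (k : ℤ) u₁ ^ 2 ≤
      E₀ - (∑ j ∈ Finset.range (k + 1), ∑ i : Fin 4, (1 / 2 : ℝ) * X i (j : ℤ) u₂ ^ 2) +
        (1 / 2 : ℝ) * X 1 (k : ℤ) u₂ ^ 2 := by
  have hb : (0 : ℝ) < 1 + ε₀ := by linarith
  have hsub : Icc u₁ u₂ ⊆ Icc (0 : ℝ) s := Icc_subset_Icc hu₁ hu₂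
  have hG := fun (w : ℝ) (hw : w ∈ Icc u₁ u₂) =>
    (sideBranch_liveBlock_hasDerivWithinAt hlow hder k (hsub hw)).mono hsub
  have hnn : ∀ w ∈ Icc u₁ u₂, 0 ≤ botSum ε₀ sideBranchTable X (k : ℤ) w +
      (∑ j ∈ Finset.range (k + 1), ∑ i : Fin 4,
        ν * (1 + ε₀) ^ ((2 : ℝ) * ((j : ℤ) : ℝ)) * X i (j : ℤ) w ^ 2) +
      X 1 (k : ℤ) w * (quadTerm ε₀ sideBranchTable X 1 (k : ℤ) w -
        ν * (1 + ε₀) ^ ((2 : ℝ) * ((k : ℤ) : ℝ)) * X 1 (k : ℤ) w) := by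
    intro w hw
    have hw' := hsub hw
    have h1 := sideBranch_liveBlock_deriv_ge (X := X) hε hν k (hpos w hw' 1 _ (by positivity))
    have h2 : 0 ≤ (1 + ε₀) ^ ((5 : ℝ) * ((k : ℤ) : ℝ) / 2) * X 0 (k : ℤ) w ^ 2 * X 0 ((k : ℤ) + 1) w :=
      mul_nonneg (mul_nonneg (Real.rpow_nonneg hb.le _) (sq_nonneg _)) (hpos w hw' 0 _ (by positivity))
    exact h2.trans h1
  have h := sideBranch_le_of_deriv_nonneg hG hnn (right_mem_Icc.2 hu)
  linarith

/-- **The driver identity one shell up** (pure algebra): with `A_k = E₀ − B_k + ½s_k²`,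
`½x_{k+1}² = (A_k − A_{k+1}) − ½s_k² − ½z_{k+1}² − ½X_{3,k+1}²`. [this file] -/
theorem sideBranch_chain_sq_succ (k : ℕ) (E₀ u : ℝ) :
    (1 / 2 : ℝ) * X 0 ((k + 1 : ℕ) : ℤ) u ^ 2 =
      ((E₀ - (∑ j ∈ Finset.range (k + 1), ∑ i : Fin 4, (1 / 2 : ℝ) * X i (j : ℤ) u ^ 2) +
          (1 / 2 : ℝ) * X 1 (k : ℤ) u ^ 2) -
        (E₀ - (∑ j ∈ Finset.range (k + 1 + 1), ∑ i : Fin 4, (1 / 2 : ℝ) * X i (j : ℤ) u ^ 2) +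
          (1 / 2 : ℝ) * X 1 ((k + 1 : ℕ) : ℤ) u ^ 2)) -
        (1 / 2 : ℝ) * X 1 (k : ℤ) u ^ 2 - (1 / 2 : ℝ) * X 2 ((k + 1 : ℕ) : ℤ) u ^ 2 -
        (1 / 2 : ℝ) * X 3 ((k + 1 : ℕ) : ℤ) u ^ 2 := by
  rw [Finset.sum_range_succ _ (k + 1), Fin.sum_univ_four]
  ring

/-- **The driver identity on the datum shell** (pure algebra): `½x_0² = E₀ − A_0 − ½z_0² − ½X_{3,0}²`
with `A_0 = E₀ − B_0 + ½s_0²`. [this file] -/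
theorem sideBranch_chain_sq_zero (E₀ u : ℝ) :
    (1 / 2 : ℝ) * X 0 ((0 : ℕ) : ℤ) u ^ 2 =
      E₀ - (E₀ - (∑ j ∈ Finset.range (0 + 1), ∑ i : Fin 4, (1 / 2 : ℝ) * X i (j : ℤ) u ^ 2) +
          (1 / 2 : ℝ) * X 1 ((0 : ℕ) : ℤ) u ^ 2) -
        (1 / 2 : ℝ) * X 2 ((0 : ℕ) : ℤ) u ^ 2 - (1 / 2 : ℝ) * X 3 ((0 : ℕ) : ℤ) u ^ 2 := by
  rw [zero_add, Finset.sum_range_one, Fin.sum_univ_four]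
  push_cast
  ring

end Solution

end Summit.NavierStokesRegularity.NavierStokesRegularity.Theorems.SubOnsagerCeiling

end
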